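import Summits.ABC.StewartYu.MultiquadraticLiouvilleExt
import Literature.NumberTheory.LFunctions.DworkRationalityBorelDwork
import HarnessLib

/-!
# Cell abc-stewartyu, WP-Y (route M2 `PadicPrimesYuNinety`, infrastructure I1, sequel): the sharp
# multiquadratic Liouville inequality in `ℂ_p` (and, as a check, in `ℚ_p`)

`Summits/ABC/StewartYu/PadicComplexLiouville.lean` — cell `abc-stewartyu` (HOME
`run/shared/lean/pub/abc-stewartyu/`, seat p3; theorems only, no definition, no named fact), sequel to
`MultiquadraticLiouvilleExt.lean` (`MultiquadExt.norm_evL_ge_sharp_of_norm_int`: the inequality in any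
ultrametric field `L` of characteristic zero with `‖z‖ ≤ 1` on `ℤ` and `‖n‖ ≥ 1/n` on `ℕ_{>0}`).

Here the two hypotheses are discharged for `L = ℂ_[p]` (Mathlib `PadicComplex`: the norm extends the
one of `ℚ_p`, `PadicComplex.norm_extends'`; `ℂ_p` is ultrametric and algebraically closed), giving

* `PadicComplexFacts.inv_natCast_le_norm_natCast`, `….norm_ratCast_eq` (integers of norm `≤ 1`:
  the tree's `Literature.NumberTheory.LFunctions.Dwork.norm_intCast_le_one`, reused);
* `PadicComplexFacts.exists_sq_eq_of_norm_le_one` / `…_eq_one` / `exists_roots_of_norm_le_one`: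
  every `a ∈ ℂ_p` with `‖a‖ ≤ 1` (`= 1`) has a square root of norm `≤ 1` (`= 1`) — so the roots
  `sⱼ`, `sⱼ² = αⱼ`, `‖sⱼ‖ ≤ 1` exist in `ℂ_p` for ALL rationals `αⱼ` with `‖αⱼ‖_p ≤ 1`
  (`-1`, primes `q ≠ p`, …), which is what Yu's twist engine needs at the half points
  (Yu 1990 Lemma 2.4, pp. 53–56: `E = ℚ(α₀^{1/2}, α₁^{1/2}, …, αₙ^{1/2}) ↪ ℂ_p`, `α₀ = -1` for
  `K = ℚ`; lit dossier HOME/lit/SOURCES.md §11.5 (iv));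
* `MultiquadExt.norm_evL_ge_sharp_padicComplex` — the inequality in `ℂ_[p]`;
* `MultiquadExt.norm_evL_ge_sharp_padic'` — the `ℚ_[p]` instance (the landed
  `Multiquad.norm_evL_ge_sharp` re-derived from the general statement: the generalisation loses
  nothing).

Everything is [folklore]; nothing here is claimed to be in print. WHAT THIS IS NOT: not the half-step
of the twist engine (that needs Yu's `h*`-bookkeeping (2.93)–(2.95) to write the value as an `evL`).
-/

noncomputable section

open Finset Literature.NumberTheory.Transcendental.CW77

namespace Summit.ABC.StewartYu

namespace MultiquadExt

open Literature.NumberTheory.Transcendental Multiquad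

/-- The `ℚ_p` instance of `norm_evL_ge_sharp_of_norm_int` — the landed
`Multiquad.norm_evL_ge_sharp`, re-derived from the general statement (certifies that the
generalisation specialises back). [folklore] -/
theorem norm_evL_ge_sharp_padic' {p : ℕ} [Fact p.Prime] (k : ℕ) (α : Fin k → ℚ)
    (hind : ∀ T : Finset (Fin k), T.Nonempty → ¬ IsSquare (∏ j ∈ T, α j))
    (s : Fin k → ℚ_[p]) (hs : ∀ j, s j * s j = (α j : ℚ_[p])) (hs1 : ∀ j, ‖s j‖ ≤ 1)
    (c : Finset (Fin k) → ℚ) (hc : c ≠ 0) (D : ℕ) (hD : 1 ≤ D)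
    (hden : ∀ S, ∃ z : ℤ, (D : ℚ) * c S = z) (M : ℝ) (hM : 1 ≤ M) (hcM : ∑ S, |(c S : ℝ)| ≤ M) :
    (D : ℝ) / (4 * (D : ℝ) ^ 2 * M * heightProd α ^ 3) ^ (2 ^ k) ≤ ‖evL s c‖ :=
  norm_evL_ge_sharp_of_norm_int (fun z => Padic.norm_int_le_one z)
    (fun _ hn => inv_natCast_le_norm_natCast hn) k α hind s hs hs1 c hc D hD hden M hM hcM

end MultiquadExt

/-! ### `ℂ_p` facts: the norm on `ℤ ⊂ ℂ_p`, square roots of integral elements -/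

namespace PadicComplexFacts

variable {p : ℕ} [Fact p.Prime]

/-- The coercion `ℚ_p → ℂ_p` on an integer is the integer of `ℂ_p`. [folklore] -/
theorem coe_intCast (z : ℤ) : ((z : ℚ_[p]) : ℂ_[p]) = (z : ℂ_[p]) := by
  rw [show ((z : ℚ_[p]) : ℂ_[p]) = algebraMap ℚ_[p] ℂ_[p] (z : ℚ_[p]) from rfl, map_intCast]

/-- The coercion `ℚ_p → ℂ_p` on a natural number is the natural number of `ℂ_p`. [folklore] -/
theorem coe_natCast (n : ℕ) : ((n : ℚ_[p]) : ℂ_[p]) = (n : ℂ_[p]) := by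
  rw [show ((n : ℚ_[p]) : ℂ_[p]) = algebraMap ℚ_[p] ℂ_[p] (n : ℚ_[p]) from rfl, map_natCast]

/-- The coercion `ℚ_p → ℂ_p` on a rational number is the rational number of `ℂ_p`. [folklore] -/
theorem coe_ratCast (q : ℚ) : ((q : ℚ_[p]) : ℂ_[p]) = (q : ℂ_[p]) := by
  rw [show ((q : ℚ_[p]) : ℂ_[p]) = algebraMap ℚ_[p] ℂ_[p] (q : ℚ_[p]) from rfl, map_ratCast]

/-- The norm of a rational number in `ℂ_p` is its `p`-adic norm. [folklore] -/
theorem norm_ratCast_eq (q : ℚ) : ‖(q : ℂ_[p])‖ = ‖(q : ℚ_[p])‖ := by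
  rw [← coe_ratCast, PadicComplex.norm_extends']

/-- `‖n‖ ≥ 1/n` in `ℂ_p` for a positive integer `n` (product formula). [folklore] -/
theorem inv_natCast_le_norm_natCast {n : ℕ} (hn : n ≠ 0) : (n : ℝ)⁻¹ ≤ ‖(n : ℂ_[p])‖ := by
  rw [← coe_natCast, PadicComplex.norm_extends']
  exact Literature.NumberTheory.Transcendental.inv_natCast_le_norm_natCast hn

/-- In `ℂ_p` every element has a square root (`ℂ_p` is algebraically closed), and a square root of an
element of norm `≤ 1` has norm `≤ 1`. [folklore] -/
theorem exists_sq_eq_of_norm_le_one (a : ℂ_[p]) (ha : ‖a‖ ≤ 1) :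
    ∃ s : ℂ_[p], s * s = a ∧ ‖s‖ ≤ 1 := by
  obtain ⟨s, hs⟩ := IsAlgClosed.exists_eq_mul_self a
  refine ⟨s, hs.symm, ?_⟩
  have h2 : ‖s‖ * ‖s‖ ≤ 1 := by rw [← norm_mul, ← hs]; exact ha
  by_contra h
  have h' : 1 < ‖s‖ := not_le.mp h
  have : 1 < ‖s‖ * ‖s‖ := by nlinarith
  linarith

/-- In `ℂ_p` every element of norm `1` has a square root of norm `1` (e.g. `-1`, a prime `q ≠ p`, a
`(p-1)`-th root of unity). [folklore] -/
theorem exists_sq_eq_of_norm_eq_one (a : ℂ_[p]) (ha : ‖a‖ = 1) :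
    ∃ s : ℂ_[p], s * s = a ∧ ‖s‖ = 1 := by
  obtain ⟨s, hs, hs1⟩ := exists_sq_eq_of_norm_le_one a ha.le
  refine ⟨s, hs, le_antisymm hs1 ?_⟩
  have h2 : ‖s‖ * ‖s‖ = 1 := by rw [← norm_mul, hs, ha]
  by_contra h
  have h' : ‖s‖ < 1 := not_le.mp h
  have hs0 : 0 ≤ ‖s‖ := norm_nonneg _
  have : ‖s‖ * ‖s‖ < 1 := by nlinarith
  linarith

/-- A family of rationals of `p`-adic norm `≤ 1` has a family of square roots of norm `≤ 1` in `ℂ_p`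
(the hypothesis "`sⱼ ∈ L`, `sⱼ² = αⱼ`, `‖sⱼ‖ ≤ 1`" of the Liouville inequality is inhabited in `ℂ_p`).
[folklore] -/
theorem exists_roots_of_norm_le_one {k : ℕ} (α : Fin k → ℚ) (hα : ∀ j, ‖(α j : ℚ_[p])‖ ≤ 1) :
    ∃ s : Fin k → ℂ_[p], (∀ j, s j * s j = (α j : ℂ_[p])) ∧ ∀ j, ‖s j‖ ≤ 1 := by
  have h : ∀ j, ∃ s : ℂ_[p], s * s = (α j : ℂ_[p]) ∧ ‖s‖ ≤ 1 := fun j =>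
    exists_sq_eq_of_norm_le_one _ (by rw [norm_ratCast_eq]; exact hα j)
  choose s hs using h
  exact ⟨s, fun j => (hs j).1, fun j => (hs j).2⟩

end PadicComplexFacts

namespace MultiquadExt

open Literature.NumberTheory.Transcendental Multiquad

/-- **The SHARP multiquadratic Liouville inequality in `ℂ_p`.** For rationals `αⱼ` with
`𝔽₂`-independent square classes, elements `sⱼ ∈ ℂ_p` with `sⱼ² = αⱼ` and `‖sⱼ‖ ≤ 1`, and a non-zero
coefficient vector `c` with `D c_S ∈ ℤ`, `∑ |c_S| ≤ M` (`D, M ≥ 1`):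
`‖∑_S c_S ∏_{j∈S} sⱼ‖ ≥ D / (4 D² M (∏ⱼ H(αⱼ))³)^{2ᵏ}` in `ℂ_p`. This is the form needed at the half
points of Yu's twist engine (Yu 1990 Lemma 2.4: `E = ℚ(α₀^{1/2}, α₁^{1/2}, …) ↪ ℂ_p`, `α₀ = -1`).
[folklore] -/
theorem norm_evL_ge_sharp_padicComplex {p : ℕ} [Fact p.Prime] (k : ℕ) (α : Fin k → ℚ)
    (hind : ∀ T : Finset (Fin k), T.Nonempty → ¬ IsSquare (∏ j ∈ T, α j))
    (s : Fin k → ℂ_[p]) (hs : ∀ j, s j * s j = (α j : ℂ_[p])) (hs1 : ∀ j, ‖s j‖ ≤ 1)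
    (c : Finset (Fin k) → ℚ) (hc : c ≠ 0) (D : ℕ) (hD : 1 ≤ D)
    (hden : ∀ S, ∃ z : ℤ, (D : ℚ) * c S = z) (M : ℝ) (hM : 1 ≤ M) (hcM : ∑ S, |(c S : ℝ)| ≤ M) :
    (D : ℝ) / (4 * (D : ℝ) ^ 2 * M * heightProd α ^ 3) ^ (2 ^ k) ≤ ‖evL s c‖ :=
  norm_evL_ge_sharp_of_norm_int (fun z => Literature.NumberTheory.LFunctions.Dwork.norm_intCast_le_one p z)
    (fun _ hn => PadicComplexFacts.inv_natCast_le_norm_natCast hn) k α hind s hs hs1 c hc D hD hden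
    M hM hcM

/-- Non-vanishing in `ℂ_p`: under the `2`-Kummer condition a non-zero coefficient vector evaluates to
a non-zero element of `ℂ_p` (the landed `Multiquad.evL_ne_zero`, any field of characteristic zero).
[folklore] -/
theorem evL_ne_zero_padicComplex {p : ℕ} [Fact p.Prime] {k : ℕ} (α : Fin k → ℚ)
    (hind : ∀ T : Finset (Fin k), T.Nonempty → ¬ IsSquare (∏ j ∈ T, α j))
    (s : Fin k → ℂ_[p]) (hs : ∀ j, s j * s j = (α j : ℂ_[p])) {c : Finset (Fin k) → ℚ}
    (hc : c ≠ 0) : evL s c ≠ 0 :=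
  evL_ne_zero α hind s hs hc

end MultiquadExt

end Summit.ABC.StewartYu

end
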